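import Mathlib
import HarnessLib
import Summits.HubbardSuperconductivity.HubbardSuperconductivity.Theorems.KLProgrammeKLRegimeCountertermJacksonRemainderCurve
import Summits.HubbardSuperconductivity.HubbardSuperconductivity.Theorems.KLProgrammeKLRegimeFlowShellJets

/-!
# Route `KLProgramme`, crux K3 — engine-flow child (stmt-HubbardSuperconductivity-20437), stub (C) `stub_twoLeg_curvature`, (C1) door, FAR part:
# DIFFERENTIATION UNDER THE JACKSON INTEGRAL ALONG A CURVE — `∂_θᵏ ∫ J̃J̃(w)·F(γ(θ) − w) dμ = ∫ J̃J̃(w)·∂_θᵏ[F(γ(·) − w)](θ) dμ`, `k ≤ 4`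

Cell gate-hubbard-kl, seat hubbard-kl-k3c3-p3 (g6).  The displaced-curve («co-moving») variant of k3c3-p1's Jackson-remainder door
(`jacksonRemainder_curve_jets`, p533543; asked for at KL STATUS 2026-08-27 14:15:34Z) needs the θ-derivatives of `θ ↦ (𝒥_d F)(γ θ)` written as
Jackson integrals of the θ-derivatives of the DISPLACED compositions `θ ↦ F(γ θ − w)` — so that the far (cutoff-shell) part is controlled by
`sup_{w far} |∂ᵏ_θ F(γ(·) − w)|` (small along displaced curves: `…KLRegimeFlowShellJets`) instead of the Cartesian sizes `B l·Dˡ`.  This file is that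
finite-order parametric differentiation (F ∈ C⁴ only; Mathlib's `hasDerivAt_integral_of_dominated_loc_of_deriv_le` iterated along the EXPLICIT
chain expressions of `…PerturbedFermiCurveCompChain`, domination by the Bell bounds of `…CompChainStruct` at global sizes):
* §1 the displaced curves `γ_v := γ − v` (same jets as `γ`) and the Bell-polynomial sizes of `∂ᵏ[F∘γ_v]`, uniformly in `v`;
* §2 `hasDerivAt_jweight_integral`: ONE abstract step of dominated differentiation against the weight `jweight d` on `jmeas`;
* §3 **`iteratedDeriv_jacksonCurve_eq`**: for `k ≤ 4`,
  `iteratedDeriv k (fun θ => ∫ J̃J̃(w)·F(γθ − jshift w) dμ) θ = ∫ J̃J̃(w)·iteratedDeriv k (fun θ => F(γθ − jshift w)) θ dμ`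
  (four steps along the explicit chain expressions `E₁ … E₄`), and `continuous_iteratedDeriv_comp_curve_jshift` (the displaced jets are
  continuous in `w`, hence `jmeas`-integrable: `integrable_jmeas_of_continuous`);
* §4 the same read on the tree's objects: `iteratedDeriv_jsmooth_comp_curve_eq` (`𝒥_d F` along `γ`) and **`iteratedDeriv_jhigh1_comp_curve_eq`**
  (`∂ᵏ(jhigh1 d F ∘ ofLp ∘ γ)(θ) = ∂ᵏ(G∘γ)(θ) − ∫ J̃J̃(w)·∂ᵏ(G∘γ_{jshift w})(θ) dμ`, `G = F ∘ ofLp`).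
Pure analysis; nothing about the model.  BGM 2006 §2.2 (2.23) [cite: BenfattoGiulianiMastropietro2006].
-/

noncomputable section

namespace Summit.HubbardSuperconductivity.HubbardSuperconductivity.Theorems.KLRegimeSplit

set_option linter.dupNamespace false -- summit = problem name (single-conjunct summit), D-0017
set_option maxSynthPendingDepth 4 -- nested operator-norm instances

open Real Set MeasureTheory Filter
open Summit.HubbardSuperconductivity.HubbardSuperconductivity.Theorems.PerturbedFermiCurve

section Curve

variable (d : ℕ) {F : EuclideanSpace ℝ (Fin 2) → ℝ} (hF : ContDiff ℝ 4 F) {B : ℕ → ℝ}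
  (hB : ∀ i ≤ 4, ∀ y, ‖iteratedFDeriv ℝ i F y‖ ≤ B i)
  {γ : ℝ → EuclideanSpace ℝ (Fin 2)} (hγ : ContDiff ℝ 4 γ) {D : ℕ → ℝ} (hD : ∀ i, 1 ≤ i → i ≤ 4 → ∀ θ, ‖iteratedDeriv i γ θ‖ ≤ D i)

/-! ## §1 Displaced curves (`contDiff_translate`, `iteratedDeriv_translate` of `…FlowShellJets`) and the sizes of the displaced chain -/

include hγ in
/-- The derivative tower of the displaced curves: `∂(γ − v) = γ′` and `∂(iteratedDeriv i γ) = iteratedDeriv (i+1) γ`. -/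
theorem hasDerivAt_curve_sub (v : EuclideanSpace ℝ (Fin 2)) (θ : ℝ) : HasDerivAt (fun θ : ℝ => γ θ - v) (iteratedDeriv 1 γ θ) θ := by
  have h := hasDerivAt_iteratedDeriv_of_contDiff_four hγ (show 0 < 4 by norm_num) θ
  simp only [iteratedDeriv_zero] at h
  exact h.sub_const v

include hF hB hγ hD in
/-- **Size of the displaced chain**: `|∂ᵏ[F∘(γ − v)](θ)| ≤ bell k`, `bell 1 = B₁D₁`, `bell 2 = B₂D₁² + B₁D₂`, `bell 3 = B₃D₁³ + 3B₂D₁D₂ + B₁D₃`,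
`bell 4 = B₄D₁⁴ + 6B₃D₁²D₂ + 3B₂D₂² + 4B₂D₁D₃ + B₁D₄` — uniformly in `v` and `θ`. -/
theorem abs_iteratedDeriv_comp_curve_sub_le (v : EuclideanSpace ℝ (Fin 2)) (θ : ℝ) :
    |iteratedDeriv 1 (F ∘ fun θ : ℝ => γ θ - v) θ| ≤ B 1 * D 1 ∧
    |iteratedDeriv 2 (F ∘ fun θ : ℝ => γ θ - v) θ| ≤ B 2 * D 1 ^ 2 + B 1 * D 2 ∧
    |iteratedDeriv 3 (F ∘ fun θ : ℝ => γ θ - v) θ| ≤ B 3 * D 1 ^ 3 + 3 * B 2 * D 1 * D 2 + B 1 * D 3 ∧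
    |iteratedDeriv 4 (F ∘ fun θ : ℝ => γ θ - v) θ| ≤
      B 4 * D 1 ^ 4 + 6 * B 3 * D 1 ^ 2 * D 2 + 3 * B 2 * D 2 ^ 2 + 4 * B 2 * D 1 * D 3 + B 1 * D 4 := by
  have hγv := contDiff_translate hγ v
  have m := fun i (hi : i ≤ 4) => hB i hi (γ θ - v)
  have j1 : ‖iteratedDeriv 1 (fun θ : ℝ => γ θ - v) θ‖ ≤ D 1 := by rw [iteratedDeriv_translate hγ v le_rfl (by norm_num)]; exact hD 1 le_rfl (by norm_num) θ
  have j2 : ‖iteratedDeriv 2 (fun θ : ℝ => γ θ - v) θ‖ ≤ D 2 := by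
    rw [iteratedDeriv_translate hγ v (by norm_num) (by norm_num)]; exact hD 2 (by norm_num) (by norm_num) θ
  have j3 : ‖iteratedDeriv 3 (fun θ : ℝ => γ θ - v) θ‖ ≤ D 3 := by
    rw [iteratedDeriv_translate hγ v (by norm_num) (by norm_num)]; exact hD 3 (by norm_num) (by norm_num) θ
  have j4 : ‖iteratedDeriv 4 (fun θ : ℝ => γ θ - v) θ‖ ≤ D 4 := by
    rw [iteratedDeriv_translate hγ v (by norm_num) (by norm_num)]; exact hD 4 (by norm_num) le_rfl θ
  exact ⟨abs_iteratedDeriv_one_comp_le_struct hF hγv (m 1 (by norm_num)) j1,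
    abs_iteratedDeriv_two_comp_le_struct hF hγv (m 1 (by norm_num)) (m 2 (by norm_num)) j1 j2,
    abs_iteratedDeriv_three_comp_le_struct hF hγv (m 1 (by norm_num)) (m 2 (by norm_num)) (m 3 (by norm_num)) j1 j2 j3,
    abs_iteratedDeriv_four_comp_le_struct hF hγv (m 1 (by norm_num)) (m 2 (by norm_num)) (m 3 (by norm_num)) (m 4 le_rfl) j1 j2 j3 j4⟩


/-! ## §2 One abstract step of dominated differentiation against the Jackson weight -/

omit hF hγ in
/-- **One step**: if `θ ↦ Ek θ w` has derivative `Ek1 θ w` for every `w`, both are continuous in `w`, and `|Ek1| ≤ K` uniformly, then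
`θ ↦ ∫ J̃J̃(w)·Ek θ w dμ` has derivative `∫ J̃J̃(w)·Ek1 θ w dμ`. -/
theorem hasDerivAt_jweight_integral {Ek Ek1 : ℝ → ℝ × ℝ → ℝ} (ha : ∀ w θ, HasDerivAt (fun θ => Ek θ w) (Ek1 θ w) θ)
    (hb : ∀ θ, Continuous fun w => Ek θ w) (hb1 : ∀ θ, Continuous fun w => Ek1 θ w) {K : ℝ} (hK : ∀ θ w, |Ek1 θ w| ≤ K) (θ : ℝ) :
    HasDerivAt (fun θ => ∫ w, jweight d w • Ek θ w ∂jmeas) (∫ w, jweight d w • Ek1 θ w ∂jmeas) θ := by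
  have hC := jweight_le d
  set C : ℝ := (π ^ 4 * (d + 1) / 8 / (2 * π)) * (π ^ 4 * (d + 1) / 8 / (2 * π)) with hCdef
  have h := hasDerivAt_integral_of_dominated_loc_of_deriv_le (μ := jmeas) (F := fun θ w => jweight d w • Ek θ w)
    (F' := fun θ w => jweight d w • Ek1 θ w) (x₀ := θ) (s := Set.univ) (bound := fun _ => C * K) Filter.univ_mem
    (Eventually.of_forall fun θ' => ((continuous_jweight d).smul (hb θ')).aestronglyMeasurable)
    (integrable_jmeas_of_continuous ((continuous_jweight d).smul (hb θ)))
    ((continuous_jweight d).smul (hb1 θ)).aestronglyMeasurable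
    (Eventually.of_forall fun w θ' _ => by
      rw [norm_smul, Real.norm_eq_abs, Real.norm_eq_abs, abs_of_nonneg (jweight_nonneg d w)]
      exact mul_le_mul (hC w) (hK θ' w) (abs_nonneg _) (le_trans (jweight_nonneg d w) (hC w)))
    (integrable_jmeas_of_continuous continuous_const)
    (Eventually.of_forall fun w θ' _ => (ha w θ').const_smul (jweight d w))
  exact h.2

/-! ## §3 The four steps along the displaced curves and the iterated-derivative identity -/

include hF in
/-- `DF` is continuous. -/
private theorem cont_fderiv1 : Continuous (fderiv ℝ F) := (hF.fderiv_right (m := 3) (by norm_num)).continuous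
include hF in
/-- `D²F` is continuous. -/
private theorem cont_fderiv2 : Continuous (fderiv ℝ (fderiv ℝ F)) :=
  ((hF.fderiv_right (m := 3) (by norm_num)).fderiv_right (m := 2) (by norm_num)).continuous
include hF in
/-- `D³F` is continuous. -/
private theorem cont_fderiv3 : Continuous (fderiv ℝ (fderiv ℝ (fderiv ℝ F))) :=
  (((hF.fderiv_right (m := 3) (by norm_num)).fderiv_right (m := 2) (by norm_num)).fderiv_right (m := 1) (by norm_num)).continuous
include hF in
/-- `D⁴F` is continuous. -/
private theorem cont_fderiv4 : Continuous (fderiv ℝ (fderiv ℝ (fderiv ℝ (fderiv ℝ F)))) :=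
  ((((hF.fderiv_right (m := 3) (by norm_num)).fderiv_right (m := 2) (by norm_num)).fderiv_right (m := 1) (by norm_num)).fderiv_right
    (m := 0) (by norm_num)).continuous

include hF hB hγ hD in
/-- The engine: continuity in `w` of the displaced jets AND the identity, orders `k ≤ 4` (shared chain expressions `E₀ … E₄`). -/
private theorem jacksonCurve_aux :
    (∀ k ≤ 4, ∀ θ : ℝ, Continuous fun w : ℝ × ℝ => iteratedDeriv k (F ∘ fun θ : ℝ => γ θ - jshift w) θ) ∧
    ∀ k ≤ 4, ∀ θ : ℝ, iteratedDeriv k (fun θ : ℝ => ∫ w, jweight d w • F (γ θ - jshift w) ∂jmeas) θ =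
      ∫ w, jweight d w • iteratedDeriv k (F ∘ fun θ : ℝ => γ θ - jshift w) θ ∂jmeas := by
  -- towers of the curve
  have h0 := fun (w : ℝ × ℝ) (ϑ : ℝ) => hasDerivAt_curve_sub hγ (jshift w) ϑ
  have h1 := fun ϑ => hasDerivAt_iteratedDeriv_of_contDiff_four hγ (show 1 < 4 by norm_num) ϑ
  have h2 := fun ϑ => hasDerivAt_iteratedDeriv_of_contDiff_four hγ (show 2 < 4 by norm_num) ϑ
  have h3 := fun ϑ => hasDerivAt_iteratedDeriv_of_contDiff_four hγ (show 3 < 4 by norm_num) ϑ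
  -- the chain expressions (curve jets of `γ` itself)
  set E0 : ℝ → ℝ × ℝ → ℝ := fun ϑ w => F (γ ϑ - jshift w) with hE0
  set E1 : ℝ → ℝ × ℝ → ℝ := fun ϑ w => fderiv ℝ F (γ ϑ - jshift w) (iteratedDeriv 1 γ ϑ) with hE1
  set E2 : ℝ → ℝ × ℝ → ℝ := fun ϑ w =>
    fderiv ℝ (fderiv ℝ F) (γ ϑ - jshift w) (iteratedDeriv 1 γ ϑ) (iteratedDeriv 1 γ ϑ) + fderiv ℝ F (γ ϑ - jshift w) (iteratedDeriv 2 γ ϑ) with hE2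
  set E3 : ℝ → ℝ × ℝ → ℝ := fun ϑ w =>
    fderiv ℝ (fderiv ℝ (fderiv ℝ F)) (γ ϑ - jshift w) (iteratedDeriv 1 γ ϑ) (iteratedDeriv 1 γ ϑ) (iteratedDeriv 1 γ ϑ) +
          fderiv ℝ (fderiv ℝ F) (γ ϑ - jshift w) (iteratedDeriv 2 γ ϑ) (iteratedDeriv 1 γ ϑ) +
        fderiv ℝ (fderiv ℝ F) (γ ϑ - jshift w) (iteratedDeriv 1 γ ϑ) (iteratedDeriv 2 γ ϑ) +
      (fderiv ℝ (fderiv ℝ F) (γ ϑ - jshift w) (iteratedDeriv 1 γ ϑ) (iteratedDeriv 2 γ ϑ) + fderiv ℝ F (γ ϑ - jshift w) (iteratedDeriv 3 γ ϑ))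
    with hE3
  set E4 : ℝ → ℝ × ℝ → ℝ := fun ϑ w =>
    fderiv ℝ (fderiv ℝ (fderiv ℝ (fderiv ℝ F))) (γ ϑ - jshift w) (iteratedDeriv 1 γ ϑ) (iteratedDeriv 1 γ ϑ) (iteratedDeriv 1 γ ϑ)
            (iteratedDeriv 1 γ ϑ) +
          fderiv ℝ (fderiv ℝ (fderiv ℝ F)) (γ ϑ - jshift w) (iteratedDeriv 2 γ ϑ) (iteratedDeriv 1 γ ϑ) (iteratedDeriv 1 γ ϑ) +
          fderiv ℝ (fderiv ℝ (fderiv ℝ F)) (γ ϑ - jshift w) (iteratedDeriv 1 γ ϑ) (iteratedDeriv 2 γ ϑ) (iteratedDeriv 1 γ ϑ) +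
          fderiv ℝ (fderiv ℝ (fderiv ℝ F)) (γ ϑ - jshift w) (iteratedDeriv 1 γ ϑ) (iteratedDeriv 1 γ ϑ) (iteratedDeriv 2 γ ϑ) +
        (fderiv ℝ (fderiv ℝ (fderiv ℝ F)) (γ ϑ - jshift w) (iteratedDeriv 1 γ ϑ) (iteratedDeriv 2 γ ϑ) (iteratedDeriv 1 γ ϑ) +
            fderiv ℝ (fderiv ℝ F) (γ ϑ - jshift w) (iteratedDeriv 3 γ ϑ) (iteratedDeriv 1 γ ϑ) +
          fderiv ℝ (fderiv ℝ F) (γ ϑ - jshift w) (iteratedDeriv 2 γ ϑ) (iteratedDeriv 2 γ ϑ)) +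
        (fderiv ℝ (fderiv ℝ (fderiv ℝ F)) (γ ϑ - jshift w) (iteratedDeriv 1 γ ϑ) (iteratedDeriv 1 γ ϑ) (iteratedDeriv 2 γ ϑ) +
            fderiv ℝ (fderiv ℝ F) (γ ϑ - jshift w) (iteratedDeriv 2 γ ϑ) (iteratedDeriv 2 γ ϑ) +
          fderiv ℝ (fderiv ℝ F) (γ ϑ - jshift w) (iteratedDeriv 1 γ ϑ) (iteratedDeriv 3 γ ϑ)) +
        (fderiv ℝ (fderiv ℝ (fderiv ℝ F)) (γ ϑ - jshift w) (iteratedDeriv 1 γ ϑ) (iteratedDeriv 1 γ ϑ) (iteratedDeriv 2 γ ϑ) +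
            fderiv ℝ (fderiv ℝ F) (γ ϑ - jshift w) (iteratedDeriv 2 γ ϑ) (iteratedDeriv 2 γ ϑ) +
          fderiv ℝ (fderiv ℝ F) (γ ϑ - jshift w) (iteratedDeriv 1 γ ϑ) (iteratedDeriv 3 γ ϑ)) +
      (fderiv ℝ (fderiv ℝ F) (γ ϑ - jshift w) (iteratedDeriv 1 γ ϑ) (iteratedDeriv 3 γ ϑ) + fderiv ℝ F (γ ϑ - jshift w) (iteratedDeriv 4 γ ϑ))
    with hE4
  -- the chain: HasDerivAt in θ for every w
  have d01 : ∀ w ϑ, HasDerivAt (fun ϑ => E0 ϑ w) (E1 ϑ w) ϑ := fun w ϑ => comp_chain_one (hF.of_le (by norm_num)) (h0 w) ϑ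
  have d12 : ∀ w ϑ, HasDerivAt (fun ϑ => E1 ϑ w) (E2 ϑ w) ϑ := fun w ϑ => comp_chain_two (hF.of_le (by norm_num)) (h0 w) h1 ϑ
  have d23 : ∀ w ϑ, HasDerivAt (fun ϑ => E2 ϑ w) (E3 ϑ w) ϑ := fun w ϑ => comp_chain_three (hF.of_le (by norm_num)) (h0 w) h1 h2 ϑ
  have d34 : ∀ w ϑ, HasDerivAt (fun ϑ => E3 ϑ w) (E4 ϑ w) ϑ := fun w ϑ => comp_chain_four hF (h0 w) h1 h2 h3 ϑ
  -- the chain expressions ARE the iterated derivatives of the displaced compositions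
  have hγw := fun w => contDiff_translate hγ (jshift w)
  have js := fun (w : ℝ × ℝ) (i : ℕ) (hi : 1 ≤ i) (hi4 : i ≤ 4) (ϑ : ℝ) => iteratedDeriv_translate hγ (jshift w) hi hi4 ϑ
  have e1 : ∀ w ϑ, iteratedDeriv 1 (F ∘ fun θ : ℝ => γ θ - jshift w) ϑ = E1 ϑ w := by
    intro w ϑ; rw [iteratedDeriv_one_comp_eq hF (hγw w), js w 1 le_rfl (by norm_num)]
  have e2 : ∀ w ϑ, iteratedDeriv 2 (F ∘ fun θ : ℝ => γ θ - jshift w) ϑ = E2 ϑ w := by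
    intro w ϑ; rw [iteratedDeriv_two_comp_eq hF (hγw w), js w 1 le_rfl (by norm_num), js w 2 (by norm_num) (by norm_num)]
  have e3 : ∀ w ϑ, iteratedDeriv 3 (F ∘ fun θ : ℝ => γ θ - jshift w) ϑ = E3 ϑ w := by
    intro w ϑ
    rw [iteratedDeriv_three_comp_eq hF (hγw w), js w 1 le_rfl (by norm_num), js w 2 (by norm_num) (by norm_num), js w 3 (by norm_num) (by norm_num)]
  have e4 : ∀ w ϑ, iteratedDeriv 4 (F ∘ fun θ : ℝ => γ θ - jshift w) ϑ = E4 ϑ w := by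
    intro w ϑ
    rw [iteratedDeriv_four_comp_eq hF (hγw w), js w 1 le_rfl (by norm_num), js w 2 (by norm_num) (by norm_num), js w 3 (by norm_num) (by norm_num),
      js w 4 (by norm_num) le_rfl]
  -- uniform sizes (domination)
  obtain ⟨K1, K2, K3, K4, hK1, hK2, hK3, hK4⟩ : ∃ K1 K2 K3 K4 : ℝ, (∀ ϑ w, |E1 ϑ w| ≤ K1) ∧ (∀ ϑ w, |E2 ϑ w| ≤ K2) ∧
      (∀ ϑ w, |E3 ϑ w| ≤ K3) ∧ (∀ ϑ w, |E4 ϑ w| ≤ K4) := by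
    refine ⟨B 1 * D 1, B 2 * D 1 ^ 2 + B 1 * D 2, B 3 * D 1 ^ 3 + 3 * B 2 * D 1 * D 2 + B 1 * D 3,
      B 4 * D 1 ^ 4 + 6 * B 3 * D 1 ^ 2 * D 2 + 3 * B 2 * D 2 ^ 2 + 4 * B 2 * D 1 * D 3 + B 1 * D 4,
      fun ϑ w => ?_, fun ϑ w => ?_, fun ϑ w => ?_, fun ϑ w => ?_⟩
    · rw [← e1]; exact (abs_iteratedDeriv_comp_curve_sub_le hF hB hγ hD (jshift w) ϑ).1
    · rw [← e2]; exact (abs_iteratedDeriv_comp_curve_sub_le hF hB hγ hD (jshift w) ϑ).2.1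
    · rw [← e3]; exact (abs_iteratedDeriv_comp_curve_sub_le hF hB hγ hD (jshift w) ϑ).2.2.1
    · rw [← e4]; exact (abs_iteratedDeriv_comp_curve_sub_le hF hB hγ hD (jshift w) ϑ).2.2.2
  -- continuity in w
  have hγs : ∀ ϑ : ℝ, Continuous fun w : ℝ × ℝ => γ ϑ - jshift w := fun ϑ => continuous_const.sub continuous_jshift
  have c0 : ∀ ϑ, Continuous fun w => E0 ϑ w := fun ϑ => hF.continuous.comp (hγs ϑ)
  have c1 : ∀ ϑ, Continuous fun w => E1 ϑ w := fun ϑ => ((cont_fderiv1 hF).comp (hγs ϑ)).clm_apply continuous_const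
  have c2 : ∀ ϑ, Continuous fun w => E2 ϑ w := fun ϑ =>
    ((((cont_fderiv2 hF).comp (hγs ϑ)).clm_apply continuous_const).clm_apply continuous_const).add
      (((cont_fderiv1 hF).comp (hγs ϑ)).clm_apply continuous_const)
  have cA3 : ∀ ϑ (u v x : EuclideanSpace ℝ (Fin 2)), Continuous fun w => fderiv ℝ (fderiv ℝ (fderiv ℝ F)) (γ ϑ - jshift w) u v x :=
    fun ϑ u v x => ((((cont_fderiv3 hF).comp (hγs ϑ)).clm_apply continuous_const).clm_apply continuous_const).clm_apply continuous_const
  have cA2 : ∀ ϑ (u v : EuclideanSpace ℝ (Fin 2)), Continuous fun w => fderiv ℝ (fderiv ℝ F) (γ ϑ - jshift w) u v :=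
    fun ϑ u v => (((cont_fderiv2 hF).comp (hγs ϑ)).clm_apply continuous_const).clm_apply continuous_const
  have cA1 : ∀ ϑ (u : EuclideanSpace ℝ (Fin 2)), Continuous fun w => fderiv ℝ F (γ ϑ - jshift w) u :=
    fun ϑ u => ((cont_fderiv1 hF).comp (hγs ϑ)).clm_apply continuous_const
  have cA4 : ∀ ϑ (u v x y : EuclideanSpace ℝ (Fin 2)), Continuous fun w => fderiv ℝ (fderiv ℝ (fderiv ℝ (fderiv ℝ F))) (γ ϑ - jshift w) u v x y :=
    fun ϑ u v x y => (((((cont_fderiv4 hF).comp (hγs ϑ)).clm_apply continuous_const).clm_apply continuous_const).clm_apply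
      continuous_const).clm_apply continuous_const
  have c3 : ∀ ϑ, Continuous fun w => E3 ϑ w := fun ϑ => by
    simp only [hE3]
    exact ((((cA3 ϑ _ _ _).add (cA2 ϑ _ _)).add (cA2 ϑ _ _)).add ((cA2 ϑ _ _).add (cA1 ϑ _)))
  have c4 : ∀ ϑ, Continuous fun w => E4 ϑ w := fun ϑ => by
    simp only [hE4]
    exact
      ((((((((cA4 ϑ _ _ _ _).add (cA3 ϑ _ _ _)).add (cA3 ϑ _ _ _)).add (cA3 ϑ _ _ _)).add (((cA3 ϑ _ _ _).add (cA2 ϑ _ _)).add (cA2 ϑ _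
        _))).add (((cA3 ϑ _ _ _).add (cA2 ϑ _ _)).add (cA2 ϑ _ _))).add (((cA3 ϑ _ _ _).add (cA2 ϑ _ _)).add (cA2 ϑ _ _))).add ((cA2 ϑ _
        _).add (cA1 ϑ _)))
  -- the four dominated-differentiation steps
  have s1 : ∀ ϑ, HasDerivAt (fun θ => ∫ w, jweight d w • E0 θ w ∂jmeas) (∫ w, jweight d w • E1 ϑ w ∂jmeas) ϑ :=
    fun ϑ => hasDerivAt_jweight_integral d d01 c0 c1 hK1 ϑ
  have s2 : ∀ ϑ, HasDerivAt (fun θ => ∫ w, jweight d w • E1 θ w ∂jmeas) (∫ w, jweight d w • E2 ϑ w ∂jmeas) ϑ :=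
    fun ϑ => hasDerivAt_jweight_integral d d12 c1 c2 hK2 ϑ
  have s3 : ∀ ϑ, HasDerivAt (fun θ => ∫ w, jweight d w • E2 θ w ∂jmeas) (∫ w, jweight d w • E3 ϑ w ∂jmeas) ϑ :=
    fun ϑ => hasDerivAt_jweight_integral d d23 c2 c3 hK3 ϑ
  have s4 : ∀ ϑ, HasDerivAt (fun θ => ∫ w, jweight d w • E3 θ w ∂jmeas) (∫ w, jweight d w • E4 ϑ w ∂jmeas) ϑ :=
    fun ϑ => hasDerivAt_jweight_integral d d34 c3 c4 hK4 ϑ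
  have D1 : deriv (fun θ => ∫ w, jweight d w • E0 θ w ∂jmeas) = fun ϑ => ∫ w, jweight d w • E1 ϑ w ∂jmeas := funext fun ϑ => (s1 ϑ).deriv
  have D2 : deriv (fun θ => ∫ w, jweight d w • E1 θ w ∂jmeas) = fun ϑ => ∫ w, jweight d w • E2 ϑ w ∂jmeas := funext fun ϑ => (s2 ϑ).deriv
  have D3 : deriv (fun θ => ∫ w, jweight d w • E2 θ w ∂jmeas) = fun ϑ => ∫ w, jweight d w • E3 ϑ w ∂jmeas := funext fun ϑ => (s3 ϑ).deriv
  have D4 : deriv (fun θ => ∫ w, jweight d w • E3 θ w ∂jmeas) = fun ϑ => ∫ w, jweight d w • E4 ϑ w ∂jmeas := funext fun ϑ => (s4 ϑ).deriv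
  -- assemble by cases on k
  refine ⟨fun k hk ϑ => ?_, fun k hk θ => ?_⟩
  · interval_cases k
    · simp only [iteratedDeriv_zero, Function.comp_apply]; exact c0 ϑ
    · simp only [e1]; exact c1 ϑ
    · simp only [e2]; exact c2 ϑ
    · simp only [e3]; exact c3 ϑ
    · simp only [e4]; exact c4 ϑ
  · interval_cases k
    · simp only [iteratedDeriv_zero, Function.comp]
    · rw [iteratedDeriv_one, D1]; simp only [e1]
    · rw [iteratedDeriv_succ, iteratedDeriv_one, D1, D2]; simp only [e2]
    · rw [show (3 : ℕ) = 1 + 1 + 1 from rfl, iteratedDeriv_succ, iteratedDeriv_succ, iteratedDeriv_one, D1, D2, D3]; simp only [e3]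
    · rw [show (4 : ℕ) = 1 + 1 + 1 + 1 from rfl, iteratedDeriv_succ, iteratedDeriv_succ, iteratedDeriv_succ, iteratedDeriv_one, D1, D2, D3,
        D4]
      simp only [e4]

include hF hB hγ hD in
/-- **Continuity in the shift**: for `k ≤ 4`, `w ↦ ∂ᵏ_θ[F(γ(·) − jshift w)](θ)` is continuous on `ℝ²` (hence `jmeas`-integrable). -/
theorem continuous_iteratedDeriv_comp_curve_jshift (k : ℕ) (hk : k ≤ 4) (θ : ℝ) :
    Continuous fun w : ℝ × ℝ => iteratedDeriv k (F ∘ fun θ : ℝ => γ θ - jshift w) θ :=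
  (jacksonCurve_aux 0 hF hB hγ hD).1 k hk θ

include hF hB hγ hD in
/-- **The identity, orders `k ≤ 4`**: `iteratedDeriv k (θ ↦ ∫ J̃J̃(w)·F(γθ − jshift w) dμ) θ = ∫ J̃J̃(w)·iteratedDeriv k (θ ↦ F(γθ − jshift w)) θ dμ`
(differentiation under the Jackson integral along the curve, four times). -/
theorem iteratedDeriv_jacksonCurve_eq (k : ℕ) (hk : k ≤ 4) (θ : ℝ) :
    iteratedDeriv k (fun θ : ℝ => ∫ w, jweight d w • F (γ θ - jshift w) ∂jmeas) θ =
      ∫ w, jweight d w • iteratedDeriv k (F ∘ fun θ : ℝ => γ θ - jshift w) θ ∂jmeas :=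
  (jacksonCurve_aux d hF hB hγ hD).2 k hk θ

end Curve

/-! ## §4 The same, read on the tree's objects: the Jackson mean `jsmooth d F` and the remainder `jhigh1 d F` along a curve -/

section Smooth

variable (d : ℕ) {F : (Fin 2 → ℝ) → ℝ} (hF : Continuous F)
  (hG : ContDiff ℝ 4 (fun q : EuclideanSpace ℝ (Fin 2) => F (WithLp.ofLp q))) {B : ℕ → ℝ}
  (hB : ∀ i ≤ 4, ∀ y, ‖iteratedFDeriv ℝ i (fun q : EuclideanSpace ℝ (Fin 2) => F (WithLp.ofLp q)) y‖ ≤ B i)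
  {γ : ℝ → EuclideanSpace ℝ (Fin 2)} (hγ : ContDiff ℝ 4 γ) {D : ℕ → ℝ}
  (hD : ∀ i, 1 ≤ i → i ≤ 4 → ∀ θ, ‖iteratedDeriv i γ θ‖ ≤ D i)

include hF in
/-- Along any curve the Jackson mean IS the Jackson integral of the displaced compositions (Fubini: `jsmooth_eq_integral_translate`). -/
theorem jsmooth_comp_curve_eq :
    ((fun q : EuclideanSpace ℝ (Fin 2) => jsmooth d F (WithLp.ofLp q)) ∘ γ) =
      fun θ => ∫ w, jweight d w • (fun q : EuclideanSpace ℝ (Fin 2) => F (WithLp.ofLp q)) (γ θ - jshift w) ∂jmeas :=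
  funext fun θ => jsmooth_eq_integral_translate d hF (γ θ)

include hF hG hB hγ hD in
/-- **Jets of the Jackson mean along a curve**, `k ≤ 4`: `∂ᵏ(𝒥_d F ∘ ofLp ∘ γ)(θ) = ∫ J̃J̃(w)·∂ᵏ[(F∘ofLp)∘(γ − jshift w)](θ) dμ`. -/
theorem iteratedDeriv_jsmooth_comp_curve_eq (k : ℕ) (hk : k ≤ 4) (θ : ℝ) :
    iteratedDeriv k ((fun q : EuclideanSpace ℝ (Fin 2) => jsmooth d F (WithLp.ofLp q)) ∘ γ) θ =
      ∫ w, jweight d w •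
        iteratedDeriv k ((fun q : EuclideanSpace ℝ (Fin 2) => F (WithLp.ofLp q)) ∘ fun θ : ℝ => γ θ - jshift w) θ ∂jmeas := by
  rw [jsmooth_comp_curve_eq d hF]
  exact iteratedDeriv_jacksonCurve_eq d hG hB hγ hD k hk θ

include hF hG hB hγ in
/-- The Jackson mean along the curve is `C⁴` (as `G∘γ − jhigh1∘γ`). -/
theorem contDiff_jsmooth_comp_curve : ContDiff ℝ 4 ((fun q : EuclideanSpace ℝ (Fin 2) => jsmooth d F (WithLp.ofLp q)) ∘ γ) := by
  have hS : ((fun q : EuclideanSpace ℝ (Fin 2) => jsmooth d F (WithLp.ofLp q)) ∘ γ) =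
      ((fun q : EuclideanSpace ℝ (Fin 2) => F (WithLp.ofLp q)) ∘ γ) - ((fun q : EuclideanSpace ℝ (Fin 2) => jhigh1 d F (WithLp.ofLp q)) ∘ γ) := by
    funext θ; simp only [Function.comp_apply, Pi.sub_apply, jhigh1_apply]; ring
  rw [hS]; exact (hG.comp hγ).sub ((contDiff_jhigh1_onM d hF hG hB).comp hγ)

include hF hG hB hγ hD in
/-- **Jets of the Jackson remainder along a curve**, `k ≤ 4`:
`∂ᵏ(jhigh1 d F ∘ ofLp ∘ γ)(θ) = ∂ᵏ[(F∘ofLp)∘γ](θ) − ∫ J̃J̃(w)·∂ᵏ[(F∘ofLp)∘(γ − jshift w)](θ) dμ` — the displaced-curve form of the (C1) remainder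
(near part: `|∂ᵏ[G∘γ] − ∂ᵏ[G∘γ_w]| = O(‖w‖)` by local sizes; far part: `jweight`-mass beyond `δ` times `|∂ᵏ[G∘γ](θ)| + sup_w |∂ᵏ[G∘γ_w](θ)|`). -/
theorem iteratedDeriv_jhigh1_comp_curve_eq (k : ℕ) (hk : k ≤ 4) (θ : ℝ) :
    iteratedDeriv k ((fun q : EuclideanSpace ℝ (Fin 2) => jhigh1 d F (WithLp.ofLp q)) ∘ γ) θ =
      iteratedDeriv k ((fun q : EuclideanSpace ℝ (Fin 2) => F (WithLp.ofLp q)) ∘ γ) θ -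
        ∫ w, jweight d w •
          iteratedDeriv k ((fun q : EuclideanSpace ℝ (Fin 2) => F (WithLp.ofLp q)) ∘ fun θ : ℝ => γ θ - jshift w) θ ∂jmeas := by
  have hk' : (k : WithTop ℕ∞) ≤ 4 := by exact_mod_cast hk
  have hGγ : ContDiff ℝ 4 ((fun q : EuclideanSpace ℝ (Fin 2) => F (WithLp.ofLp q)) ∘ γ) := hG.comp hγ
  have hSγ := contDiff_jsmooth_comp_curve d hF hG hB hγ
  have hJ : ((fun q : EuclideanSpace ℝ (Fin 2) => jhigh1 d F (WithLp.ofLp q)) ∘ γ) =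
      ((fun q : EuclideanSpace ℝ (Fin 2) => F (WithLp.ofLp q)) ∘ γ) - ((fun q : EuclideanSpace ℝ (Fin 2) => jsmooth d F (WithLp.ofLp q)) ∘ γ) := by
    funext θ; simp only [Function.comp_apply, Pi.sub_apply, jhigh1_apply]
  rw [hJ, iteratedDeriv_sub (hGγ.of_le hk').contDiffAt (hSγ.of_le hk').contDiffAt, iteratedDeriv_jsmooth_comp_curve_eq d hF hG hB hγ hD k hk θ]

end Smooth

end Summit.HubbardSuperconductivity.HubbardSuperconductivity.Theorems.KLRegimeSplit

end
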